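import Summits.BirchSwinnertonDyer.BirchSwinnertonDyer.Theorems.CycTangentCMCycTangentBoundPairSupply
import Summits.BirchSwinnertonDyer.Rank1Residual.X2.AvatarValueAboveP
import Summits.BirchSwinnertonDyer.BirchSwinnertonDyer.Theorems.RamifiedSevenEllipticUnitsLemmaXiAvatarNorm
import Literature.NumberTheory.EllipticCurves.ZpExtensionSplitPrimeLineThroughPair
import Literature.NumberTheory.EllipticCurves.ZpExtensionAnticyclotomicHoldsProofs
import Literature.NumberTheory.EllipticCurves.DeShalit1987.KatzMeasureMonomialLinesFrames
import Literature.NumberTheory.GaloisRepresentations.PadicEmbeddingCompletion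
import Literature.NumberTheory.GaloisRepresentations.LAdicCharacterUnramifiedAEProofs
import HarnessLib

/-!
# Crux `CycTangentCM.CycTangentBound` (stmt-BirchSwinnertonDyer-22628), N-line assembly input (A2)/(ζ):
# SATURATION of the split-prime line — avatars of type-`(k, 0)` Hecke characters through the `ℤ_p²`-tower
# factor through the split-prime `ℤ_p`-LINE (`--supports 22628`; nothing is closed; BSD is not proved)

Seat `prover-bsd-line-ctcm-p3` (D-0145 line `route-BirchSwinnertonDyer-CycTangentCM`, prover 3/3), for the
lead's falsifier road ("N-line assembly"): the lead's interpolation characters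
(`CycTangentCMCycTangentBoundPairSupply`: `r_n = e ∘ χⁿ`, avatars of `Ψ^{Mn}`, `FactorsThroughPair κ₁ κ₂ r_n`)
must sit on ONE `ℤ_p`-line `κ` of the tower (`FactorsThroughZp κ r_n`) before the one-variable tools apply to
the restriction of the frame to that line (`IsKatzMeasure₂.isKatzBranch_monomialLine`,
`ZpExtension.avatarValueAt_eq_onePlusPow`).  The line is the SPLIT-PRIME LINE through the pair
(`ZpExtension.exists_le_kerSubgroup_inertia_of_isTopGeneratorPair`); this file proves its SATURATION and the
arithmetic input that feeds it:

* §1 `isUnramifiedAt_avatar_of_hasInfinityType_zero` — **(ζ) the avatar `r` of a Hecke character of type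
  `(k, 0)` unramified at `v̄` is unramified at `v̄`** (`ι` normalised by the frames' clause `hι`): Serre's local
  algebraicity in the tree's form `X2.PNewDisplay.avatar_entry_eq_of_isPAdicAvatarOf`; on local inertia the
  Artin image is a unit (`IsLocalArtinMap.image_inertia`), killed by `φ`, and every exponent of a local
  embedding `ι ∘ f ∘ ι_{v̄}` in the type `(k, 0)` is `0` (`embExponent_localEmbedding_eq_zero`: it induces
  `v̄ ≠ v`, so it is not a distinguished `w.embedding`); `I_{𝔓₀} = res(I_{K_v̄})` and conjugation.
* §2 `surjective_pairMap`, `avatarValueAt_eq_one_of_pairMap_eq_mul` — the pair map `Γ_K → ℤ_p²` is onto, hence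
  a quotient map; a character through the pair killing `τ₀` kills every `g` with coordinates in `ℤ_p·(κ₁τ₀, κ₂τ₀)`.
* §3 `exists_splitPrimeLine_saturated` — **(A2)** for `K` imaginary quadratic, `p` odd split, a generator pair:
  the split-prime line `κ = t'κ₁ − s'κ₂` (`(κ₁τ₀, κ₂τ₀) = pᵉ(s', t')` primitive direction of an inertia element
  `τ₀` acting non-trivially — it exists by Brink's ramification of the anticyclotomic tower and
  `toAdd_eq_zero_of_isTopGeneratorPair`) is through the pair, unramified at `v̄`, and SATURATED: every rank-one
  `r` through the pair, unramified at `v̄`, with no `p`-power torsion among its values, factors through `κ`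
  (`σ ∈ ker κ ⟹ σ^{pᵉ}` has coordinates in `ℤ_p·(κ₁τ₀, κ₂τ₀)`).  The torsion hypothesis is necessary
  (`ker κ/closure(pairKer·∏ I_𝔓) ≅ ℤ/pᵉ`) and holds when `‖r(σ) − 1‖ < |p|`
  (`avatarValueAt_torsionFree_of_norm_sub_one_lt`).
* §4 `exists_splitPrimeLine_factorsThroughZp` — §1 + §3 in the consumer's binders.

Theorems only; nothing is closed; crux 22628 stays OPEN; BSD is not proved by any of this.
References: [SerreAbelianLadic1968] Ch. III §2.3; [deShalit1987] II.4.17, III.1.8; [Greenberg1978] §4;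
[Brink2007] Cor. 1; [Washington1997] §13.1.
-/

set_option linter.dupNamespace false
set_option autoImplicit false

noncomputable section

open scoped NumberField
open NumberField IsDedekindDomain Field
open Literature Literature.NumberTheory.GaloisRepresentations Literature.NumberTheory.EllipticCurves
open Summit.BirchSwinnertonDyer.Rank1Residual.X2

namespace Summit.BirchSwinnertonDyer.BirchSwinnertonDyer.Theorems

variable {p : ℕ} [Fact p.Prime] {K : Type} [Field K] [NumberField K]

/-! ### §0. Small algebra: `GL₁`, torsion, distinct primes -/

omit [NumberField K] in
/-- If the `(0,0)` entry of `r(σ) ∈ GL₁` is `1` then `r(σ) = 1`. -/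
theorem eq_one_of_entry_eq_one {r : FramedGaloisRep K (PadicAlgCl p) 1} {σ : absoluteGaloisGroup K}
    (h : ((r σ : GL (Fin 1) (PadicAlgCl p)) : Matrix (Fin 1) (Fin 1) (PadicAlgCl p)) 0 0 = 1) :
    r σ = 1 := by
  refine Matrix.GeneralLinearGroup.ext fun i j ↦ ?_
  obtain rfl : i = 0 := Subsingleton.elim _ _
  obtain rfl : j = 0 := Subsingleton.elim _ _
  rw [h, Units.val_one, Matrix.one_apply_eq]

omit [NumberField K] in
/-- `r(σ) = 1` in `GL₁(ℚ̄_p)` as soon as `avatarValueAt r σ = 1` (a `1 × 1` matrix is its determinant). -/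
theorem eq_one_of_avatarValueAt_eq_one {r : FramedGaloisRep K (PadicAlgCl p) 1}
    {σ : absoluteGaloisGroup K} (h : avatarValueAt r σ = 1) : r σ = 1 := by
  refine eq_one_of_entry_eq_one ?_
  rw [← Matrix.det_fin_one (((r σ : GL (Fin 1) (PadicAlgCl p)) : Matrix (Fin 1) (Fin 1) (PadicAlgCl p))),
    ← Matrix.GeneralLinearGroup.val_det_apply]
  apply (algebraMap (PadicAlgCl p) ℂ_[p]).injective
  rw [map_one, ← PadicComplex.coe_eq]
  exact h

omit [NumberField K] in
/-- **No `p`-power torsion among one-units of level `|p|`**, in the currency `avatarValueAt`: if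
`‖r(σ) − 1‖ < ‖p‖` for all `σ` then `r(σ)^{pⁿ} = 1 ⟹ r(σ) = 1`
(`PadicAlgCl.eq_one_of_pow_eq_one_of_norm_sub_one_lt`, read in `ℂ_p ⊇ ℚ̄_p`). -/
theorem avatarValueAt_torsionFree_of_norm_sub_one_lt {r : FramedGaloisRep K (PadicAlgCl p) 1}
    (hsmall : ∀ σ : absoluteGaloisGroup K, ‖avatarValueAt r σ - 1‖ < ‖(p : ℂ_[p])‖)
    (σ : absoluteGaloisGroup K) (n : ℕ) (h : avatarValueAt r σ ^ p ^ n = 1) : avatarValueAt r σ = 1 := by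
  set x : PadicAlgCl p :=
    ((Matrix.GeneralLinearGroup.det (r σ : GL (Fin 1) (PadicAlgCl p)) : (PadicAlgCl p)ˣ) : PadicAlgCl p)
    with hx_def
  have hxv : avatarValueAt r σ = (x : ℂ_[p]) := rfl
  have hx1 : ‖x - 1‖ < ‖(p : PadicAlgCl p)‖ := by
    have h1 := hsmall σ
    have e1 : ((x - 1 : PadicAlgCl p) : ℂ_[p]) = avatarValueAt r σ - 1 := by
      rw [hxv, PadicComplex.coe_eq, PadicComplex.coe_eq, map_sub, map_one]
    have e2 : ((p : PadicAlgCl p) : ℂ_[p]) = (p : ℂ_[p]) := PadicComplex.coe_natCast p p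
    rw [← PadicComplex.norm_extends p (x - 1), ← PadicComplex.norm_extends p (p : PadicAlgCl p), e1, e2]
    exact h1
  have hxn : x ^ p ^ n = 1 := by
    apply (algebraMap (PadicAlgCl p) ℂ_[p]).injective
    rw [map_pow, map_one, ← PadicComplex.coe_eq, ← hxv]
    exact h
  have hx : x = 1 :=
    PadicAlgCl.eq_one_of_pow_eq_one_of_norm_sub_one_lt hx1 (pow_pos (Fact.out : p.Prime).pos n) hxn
  rw [hxv, hx, PadicComplex.coe_eq, map_one]

/-- Two distinct non-zero primes of `𝓞 K`: some element of the first avoids the second (both are maximal). -/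
theorem exists_mem_not_mem_of_ne {v vbar : HeightOneSpectrum (𝓞 K)} (hne : vbar ≠ v) :
    ∃ d : 𝓞 K, d ∈ vbar.asIdeal ∧ d ∉ v.asIdeal := by
  by_contra h
  push Not at h
  have hle : vbar.asIdeal ≤ v.asIdeal := fun d hd ↦ h d hd
  exact hne (HeightOneSpectrum.ext (vbar.isMaximal.eq_of_le v.isPrime.ne_top hle))

/-! ### §1. (ζ) The avatar of a type-`(k, 0)` character unramified at `v̄` is unramified at `v̄` -/

/-- **The exponent of a local embedding at `v̄` in the type `(k, 0)` is `0`**: for `K` with all infinite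
places complex, `v̄ ≠ v`, `ι` normalised by `hι` and a continuous `f : K_{v̄} → ℚ̄_p`, the complex embedding
`ι ∘ f ∘ ι_{v̄}` is not real and is no distinguished `w.embedding` (those induce `v` through `ι⁻¹`, while
`f ∘ ι_{v̄}` induces `v̄`: `‖f(d)‖ < 1 ↔ d ∈ v̄`), so its exponent is the conjugate exponent `0`. -/
theorem embExponent_localEmbedding_eq_zero (ι : PadicAlgCl p ≃+* ℂ)
    (himag : ∀ w : InfinitePlace K, w.IsComplex)
    {v vbar : HeightOneSpectrum (𝓞 K)} (hne : vbar ≠ v)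
    (hι : ∀ (w : InfinitePlace K) (d : 𝓞 K), d ∈ v.asIdeal ↔ ‖ι.symm (w.embedding (d : K))‖ < 1)
    (f : vbar.adicCompletion K →+* PadicAlgCl p) (hf : Continuous f) (k : ℤ) :
    HeckeCharacter.embExponent (fun _ : InfinitePlace K ↦ k) (fun _ ↦ (0 : ℤ))
      ((ι : PadicAlgCl p →+* ℂ).comp (f.comp (algebraMap K (vbar.adicCompletion K)))) = 0 := by
  set e := (ι : PadicAlgCl p →+* ℂ).comp (f.comp (algebraMap K (vbar.adicCompletion K))) with he
  have hnr : ¬ ComplexEmbedding.IsReal e := fun h ↦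
    (InfinitePlace.not_isReal_iff_isComplex.mpr (himag (InfinitePlace.mk e)))
      (InfinitePlace.isReal_mk_iff.mpr h)
  have hneq : ¬ e = (InfinitePlace.mk e).embedding := by
    intro heq
    obtain ⟨d, hd, hdv⟩ := exists_mem_not_mem_of_ne hne
    have h1 : ‖f (algebraMap K (vbar.adicCompletion K) ((d : 𝓞 K) : K))‖ < 1 :=
      (PadicEmbedding.norm_map_algebraMap_lt_one_iff f hf d).mpr hd
    have h2 : ι.symm ((InfinitePlace.mk e).embedding ((d : 𝓞 K) : K)) =
        f (algebraMap K (vbar.adicCompletion K) ((d : 𝓞 K) : K)) := by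
      rw [← heq, he, RingHom.comp_apply, RingHom.comp_apply, RingHom.coe_coe, RingEquiv.symm_apply_apply]
    exact hdv ((hι (InfinitePlace.mk e) d).mpr (by rw [h2]; exact h1))
  unfold HeckeCharacter.embExponent
  rw [if_neg hnr, if_neg hneq]

/-- **(ζ) The `p`-adic avatar of a Hecke character of infinity type `(k, 0)` unramified at `v̄` is
UNRAMIFIED AT `v̄`** (`r(τ) = 1` on every inertia group `I_𝔓 ≤ Γ_K`, `𝔓 ∣ v̄`; `K` with all infinite places
complex, `v̄ ≠ v` above `p`, `ι` normalised by the frames' clause `hι`): local algebraicity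
(`avatar_entry_eq_of_isPAdicAvatarOf`) on local inertia — the Artin image is a unit (`image_inertia`), killed
by `φ` (`map_localUnits_eq_one`), the algebraic factor is `∏_f f(a w)^0 = 1` — then `I_{𝔓₀} = res(I_{K_v̄})`
and conjugation. -/
theorem isUnramifiedAt_avatar_of_hasInfinityType_zero (ι : PadicAlgCl p ≃+* ℂ)
    (himag : ∀ w : InfinitePlace K, w.IsComplex)
    {v vbar : HeightOneSpectrum (𝓞 K)} (hvbar : ((p : ℕ) : 𝓞 K) ∈ vbar.asIdeal) (hne : vbar ≠ v)
    (hι : ∀ (w : InfinitePlace K) (d : 𝓞 K), d ∈ v.asIdeal ↔ ‖ι.symm (w.embedding (d : K))‖ < 1)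
    {φ : HeckeCharacter K} {k : ℤ} (hinf : φ.HasInfinityType (fun _ ↦ k) (fun _ ↦ 0))
    {T : Finset (HeightOneSpectrum (𝓞 K))} (hT : ∀ w, w ∉ T → φ.IsUnramifiedAt w)
    (hunr : φ.IsUnramifiedAt vbar)
    {r : FramedGaloisRep K (PadicAlgCl p) 1} (hav : IsPAdicAvatarOf ι φ r) :
    r.IsUnramifiedAt vbar := by
  classical
  intro 𝔓 h𝔓 τ hτ
  -- Step 1: `r` kills the restriction of the local inertia group `I_{K_v̄}`
  have key : ∀ x ∈ absInertia (vbar.adicCompletion K),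
      r (absGaloisRestrict K (vbar.adicCompletion K) x) = 1 := by
    intro x hx
    obtain ⟨a, ha⟩ := exists_isLocalArtinMap_holds (vbar.adicCompletion K)
    set w : WeilGroup (vbar.adicCompletion K) :=
      WeilGroup.mk x ⟨0, isFrobPow_zero_iff_mem_absInertia.mpr hx⟩ with hw_def
    have hwx : WeilGroup.toAbsGalois (vbar.adicCompletion K) w = x := WeilGroup.toAbsGalois_mk _ _
    have hwI : w ∈ WeilGroup.inertia (vbar.adicCompletion K) := by
      rw [WeilGroup.mem_inertia_iff, hwx]; exact hx
    have hunit : a w ∈ (ValuativeRel.valuation (vbar.adicCompletion K)).valuationSubring.unitGroup := by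
      rw [← ha.image_inertia]; exact Subgroup.mem_map_of_mem a hwI
    have hval : Valued.v ((a w : (vbar.adicCompletion K)ˣ) : vbar.adicCompletion K) = 1 := by
      rw [Valuation.mem_unitGroup_iff] at hunit
      exact (ValuativeRel.isEquiv (Valued.v : Valuation (vbar.adicCompletion K) (WithZero (Multiplicative ℤ)))
        (ValuativeRel.valuation (vbar.adicCompletion K))).eq_one_iff_eq_one.mpr hunit
    have hφ1 : φ (localUnits vbar (a w)) = 1 := hunr.map_localUnits_eq_one (a w) hval
    have hentry := PNewDisplay.avatar_entry_eq_of_isPAdicAvatarOf hinf ι hT hav hvbar a ha w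
    rw [hwx] at hentry
    have hprod : ∏ f : {e : vbar.adicCompletion K →+* PadicAlgCl p // Continuous e},
        f.1 ((a w : (vbar.adicCompletion K)ˣ) : vbar.adicCompletion K) ^
          (-HeckeCharacter.embExponent (fun _ : InfinitePlace K ↦ k) (fun _ ↦ (0 : ℤ))
            ((ι : PadicAlgCl p →+* ℂ).comp (f.1.comp (algebraMap K (vbar.adicCompletion K))))) = 1 := by
      refine Finset.prod_eq_one fun f _ ↦ ?_
      rw [embExponent_localEmbedding_eq_zero ι himag hne hι f.1 f.2 k, neg_zero, zpow_zero]
    rw [hprod, mul_one, hφ1, Units.val_one, map_one] at hentry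
    exact eq_one_of_entry_eq_one hentry
  -- Step 2: conjugate `𝔓` to the prime `𝔓₀` of the completion and lift along `res`
  obtain ⟨g, hg⟩ := HeightOneSpectrum.exists_smul_eq_of_mem_primesAbove_holds
    (adicCompletionPrime_mem_primesAbove K vbar) h𝔓
  have hτ' : g⁻¹ * τ * g ∈ (adicCompletionPrime K vbar).inertia (absoluteGaloisGroup K) :=
    (HeightOneSpectrum.mem_inertia_smul_absIntegers_iff g _ _).mp (by rw [hg]; exact hτ)
  rw [inertia_adicCompletionPrime_eq_map_absInertia] at hτ'
  obtain ⟨x, hx, hxe⟩ := Subgroup.mem_map.mp hτ'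
  have h1 : r (g⁻¹ * τ * g) = 1 := by rw [← hxe]; exact key x hx
  rw [show τ = g * (g⁻¹ * τ * g) * g⁻¹ by group, map_mul, map_mul, h1, mul_one, map_inv, mul_inv_cancel]

/-! ### §2. The pair map `Γ_K → ℤ_p²` is onto; characters through the pair are continuous in the coordinates -/

/-- **The coordinates `σ ↦ (κ₁σ, κ₂σ) : Γ_K → ℤ_p × ℤ_p` of a generator pair are ONTO**: the image is compact,
hence closed, and contains `(n, m) = (κ₁, κ₂)(γ₁ⁿ γ₂ᵐ)` for all `n, m ∈ ℕ`, a dense set. -/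
theorem surjective_pairMap {κ₁ κ₂ : ZpExtension K p} {γ₁ γ₂ : absoluteGaloisGroup K}
    (hpair : ZpExtension.IsTopGeneratorPair κ₁ κ₂ γ₁ γ₂) :
    Function.Surjective fun σ : absoluteGaloisGroup K ↦
      (Multiplicative.toAdd (κ₁ σ), Multiplicative.toAdd (κ₂ σ)) := by
  set q := fun σ : absoluteGaloisGroup K ↦ (Multiplicative.toAdd (κ₁ σ), Multiplicative.toAdd (κ₂ σ)) with hq
  have hS : IsClosed (Set.range q) := (isCompact_range ((continuous_toAdd.comp (map_continuous κ₁)).prodMk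
    (continuous_toAdd.comp (map_continuous κ₂)))).isClosed
  have h11 : Multiplicative.toAdd (κ₁ γ₁) = 1 := by rw [hpair.left]; rfl
  have h21 : Multiplicative.toAdd (κ₂ γ₁) = 0 := by rw [hpair.apply_left]; rfl
  have h12 : Multiplicative.toAdd (κ₁ γ₂) = 0 := by rw [hpair.apply_right]; rfl
  have h22 : Multiplicative.toAdd (κ₂ γ₂) = 1 := by rw [hpair.right]; rfl
  have hnat : ∀ n m : ℕ, q (γ₁ ^ n * γ₂ ^ m) = ((n : ℤ_[p]), (m : ℤ_[p])) := by
    intro n m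
    simp only [hq, map_mul, map_pow, toAdd_mul, toAdd_pow, h11, h21, h12, h22, nsmul_eq_mul, smul_zero,
      mul_one, add_zero, zero_add]
  have step1 : ∀ (m : ℕ) (a : ℤ_[p]), (a, (m : ℤ_[p])) ∈ Set.range q := fun m a ↦
    PadicInt.denseRange_natCast.induction_on (p := fun a : ℤ_[p] ↦ (a, (m : ℤ_[p])) ∈ Set.range q) a
      (hS.preimage (continuous_id.prodMk continuous_const)) (fun n ↦ ⟨γ₁ ^ n * γ₂ ^ m, hnat n m⟩)
  rintro ⟨a, b⟩
  exact PadicInt.denseRange_natCast.induction_on (p := fun b : ℤ_[p] ↦ (a, b) ∈ Set.range q) b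
    (hS.preimage (continuous_const.prodMk continuous_id)) (fun m ↦ step1 m a)

/-- **A character through the pair with `r(τ₀) = 1` kills every `g` whose coordinates are a `ℤ_p`-multiple
of those of `τ₀`** (`(κ₁g, κ₂g) = μ·(κ₁τ₀, κ₂τ₀) ⟹ r(g) = 1`): true for `μ ∈ ℕ` (`g ≡ τ₀ⁿ` modulo the pair
kernel), a closed condition in `μ` (`r` is continuous in the coordinates: the pair map is a quotient map),
and `ℕ` is dense in `ℤ_p`. -/
theorem avatarValueAt_eq_one_of_pairMap_eq_mul {κ₁ κ₂ : ZpExtension K p} {γ₁ γ₂ : absoluteGaloisGroup K}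
    (hpair : ZpExtension.IsTopGeneratorPair κ₁ κ₂ γ₁ γ₂) {r : FramedGaloisRep K (PadicAlgCl p) 1}
    (hr : FactorsThroughPair κ₁ κ₂ r) {τ₀ : absoluteGaloisGroup K} (hτ₀ : avatarValueAt r τ₀ = 1)
    (μ : ℤ_[p]) (g : absoluteGaloisGroup K)
    (h₁ : Multiplicative.toAdd (κ₁ g) = μ * Multiplicative.toAdd (κ₁ τ₀))
    (h₂ : Multiplicative.toAdd (κ₂ g) = μ * Multiplicative.toAdd (κ₂ τ₀)) :
    avatarValueAt r g = 1 := by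
  set q := fun σ : absoluteGaloisGroup K ↦ (Multiplicative.toAdd (κ₁ σ), Multiplicative.toAdd (κ₂ σ)) with hq
  have hqc : Continuous q :=
    (continuous_toAdd.comp (map_continuous κ₁)).prodMk (continuous_toAdd.comp (map_continuous κ₂))
  have hqs : Function.Surjective q := surjective_pairMap hpair
  -- `r` is constant on the fibres of `q`
  have hfib : ∀ σ τ : absoluteGaloisGroup K, q σ = q τ → avatarValueAt r σ = avatarValueAt r τ := by
    intro σ τ hστ
    simp only [hq, Prod.mk.injEq] at hστ
    have hk₁ : κ₁ (τ⁻¹ * σ) = 1 := by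
      rw [map_mul, map_inv, ← ofAdd_toAdd (κ₁ σ), ← ofAdd_toAdd (κ₁ τ), hστ.1, inv_mul_cancel]
    have hk₂ : κ₂ (τ⁻¹ * σ) = 1 := by
      rw [map_mul, map_inv, ← ofAdd_toAdd (κ₂ σ), ← ofAdd_toAdd (κ₂ τ), hστ.2, inv_mul_cancel]
    have h1 : avatarValueAt r (τ⁻¹ * σ) = 1 := by rw [avatarValueAt, hr _ hk₁ hk₂]; simp
    rw [← mul_inv_cancel_left τ σ, avatarValueAt_mul, h1, mul_one]
  -- the induced function on `ℤ_p²` and its continuity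
  set rbar : ℤ_[p] × ℤ_[p] → ℂ_[p] := fun c ↦ avatarValueAt r (Function.surjInv hqs c) with hrbar
  have hrq : ∀ σ, rbar (q σ) = avatarValueAt r σ := fun σ ↦ hfib _ _ (Function.surjInv_eq hqs (q σ))
  have hquot : Topology.IsQuotientMap q := hqc.isClosedMap.isQuotientMap hqc hqs
  have hrc : Continuous rbar := by
    rw [hquot.continuous_iff, show rbar ∘ q = fun σ ↦ avatarValueAt r σ from funext fun σ ↦ hrq σ]
    exact continuous_avatarValueAt r
  -- the closed set of good multipliers contains `ℕ`
  set s := Multiplicative.toAdd (κ₁ τ₀) with hs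
  set t := Multiplicative.toAdd (κ₂ τ₀) with ht
  have hclosed : IsClosed {ν : ℤ_[p] | rbar (ν * s, ν * t) = 1} :=
    isClosed_eq (hrc.comp ((continuous_id.mul continuous_const).prodMk
      (continuous_id.mul continuous_const))) continuous_const
  have hnatq : ∀ n : ℕ, q (τ₀ ^ n) = ((n : ℤ_[p]) * s, (n : ℤ_[p]) * t) := fun n ↦ by
    simp only [hq, map_pow, toAdd_pow, nsmul_eq_mul, hs, ht]
  have hall : ∀ ν : ℤ_[p], rbar (ν * s, ν * t) = 1 := fun ν ↦
    PadicInt.denseRange_natCast.induction_on (p := fun ν : ℤ_[p] ↦ rbar (ν * s, ν * t) = 1) ν hclosed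
      (fun n ↦ by rw [← hnatq n, hrq, RamifiedSevenEllipticUnits.LemmaXi.avatarValueAt_pow, hτ₀, one_pow])
  have hg : q g = (μ * s, μ * t) := by simp only [hq, h₁, h₂, hs, ht]
  rw [← hrq g, hg]
  exact hall μ

/-! ### §3. (A2) Saturation of the split-prime line -/

/-- **(A2) THE SPLIT-PRIME LINE THROUGH A GENERATOR PAIR IS SATURATED FOR CHARACTERS UNRAMIFIED AT `v̄`.**
For `K` imaginary quadratic, `p` odd and split (`v ≠ v̄` above `p`) and a generator pair `(κ₁, κ₂; γ₁, γ₂)`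
there is a `ℤ_p`-quotient `κ` with (i) `ker κ₁ ∩ ker κ₂ ≤ ker κ`, (ii) `I_𝔓 ≤ ker κ` for every prime `𝔓` of
`\bar ℤ_K` above `v̄`, and (iii) every rank-one `r` THROUGH THE PAIR, UNRAMIFIED AT `v̄`, whose values have
NO `p`-POWER TORSION, FACTORS THROUGH `κ`.  (`κ = t'κ₁ − s'κ₂` with `(κ₁τ₀, κ₂τ₀) = pᵉ(s', t')`, `(s', t')`
primitive, `τ₀ ∈ I_{𝔓₀}` acting non-trivially — it exists: the anticyclotomic tower is ramified above `p`
and every `ℤ_p`-quotient is through the pair; (iii): `σ ∈ ker κ` has coordinates `λ(s', t')`, so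
`r(σ)^{pᵉ} = r(σ^{pᵉ}) = 1` by §2.) -/
theorem exists_splitPrimeLine_saturated (hK : IsImaginaryQuadratic K) (hp2 : p ≠ 2)
    {v vbar : HeightOneSpectrum (𝓞 K)} (hpv : ((p : ℕ) : 𝓞 K) ∈ v.asIdeal)
    (hpvbar : ((p : ℕ) : 𝓞 K) ∈ vbar.asIdeal) (hne : vbar ≠ v)
    {κ₁ κ₂ : ZpExtension K p} {γ₁ γ₂ : absoluteGaloisGroup K}
    (hpair : ZpExtension.IsTopGeneratorPair κ₁ κ₂ γ₁ γ₂) :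
    ∃ κ : ZpExtension K p, ZpExtension.pairKer κ₁ κ₂ ≤ κ.kerSubgroup ∧
      (∀ 𝔓 ∈ vbar.primesAbove, 𝔓.inertia (absoluteGaloisGroup K) ≤ κ.kerSubgroup) ∧
      ∀ r : FramedGaloisRep K (PadicAlgCl p) 1, FactorsThroughPair κ₁ κ₂ r → r.IsUnramifiedAt vbar →
        (∀ (σ : absoluteGaloisGroup K) (n : ℕ), avatarValueAt r σ ^ p ^ n = 1 → avatarValueAt r σ = 1) →
        FactorsThroughZp κ r := by
  obtain ⟨𝔓₀, h𝔓₀⟩ := vbar.primesAbove_nonempty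
  have himag : ∀ w : InfinitePlace K, w.IsComplex := fun w ↦ hK.2.isComplex w
  -- an inertia element acting non-trivially on the tower
  obtain ⟨κa, hκa⟩ := ZpExtension.exists_isAnticyclotomic_holds (K := K) (p := p) hK.1 himag
  obtain ⟨τ₀, hτ₀, hτ₀ne⟩ :=
    ZpExtension.exists_mem_inertia_apply_ne_one_of_isAnticyclotomic hK hp2 κa hκa hpvbar h𝔓₀
  set s : ℤ_[p] := Multiplicative.toAdd (κ₁ τ₀) with hs_def
  set t : ℤ_[p] := Multiplicative.toAdd (κ₂ τ₀) with ht_def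
  have hst : ¬ (s = 0 ∧ t = 0) := by
    rintro ⟨hs0, ht0⟩
    have h1 : κ₁ τ₀ = 1 := by rw [← ofAdd_toAdd (κ₁ τ₀), ← hs_def, hs0, ofAdd_zero]
    have h2 : κ₂ τ₀ = 1 := by rw [← ofAdd_toAdd (κ₂ τ₀), ← ht_def, ht0, ofAdd_zero]
    have h3 := CycTangentCMCycTangentBoundPairSupply.toAdd_eq_zero_of_isTopGeneratorPair hK.1 himag hpair
      κa.toContinuousMonoidHom h1 h2
    rw [ZpExtension.coe_toContinuousMonoidHom] at h3
    exact hτ₀ne h3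
  obtain ⟨e, s', t', hs, ht, hunit⟩ := ZpExtension.exists_pow_mul_of_ne_zero s t hst
  have hab : IsUnit t' ∨ IsUnit (-s') := hunit.symm.imp_right IsUnit.neg
  refine ⟨ZpExtension.ofLinComb hpair t' (-s') hab,
    ZpExtension.pairKer_le_kerSubgroup_ofLinComb hpair t' (-s') hab, fun 𝔓 h𝔓 τ hτ ↦ ?_,
    fun r hrpair hrunr htors σ hσ ↦ ?_⟩
  · -- (ii) unramified at `v̄`: proportionality on `I_{𝔓₀}` and conjugation
    obtain ⟨τ₁, hτ₁, h1, h2⟩ := ZpExtension.exists_mem_inertia_apply_eq κ₁ κ₂ h𝔓₀ h𝔓 hτ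
    have hprop := ZpExtension.toAdd_mul_comm_of_mem_inertia_above hK hp2 hpv hpvbar hne κ₁ κ₂ h𝔓₀ hτ₁ hτ₀
    rw [← hs_def, ← ht_def, hs, ht, h1, h2] at hprop
    have hpe : ((p : ℤ_[p]) ^ e) ≠ 0 := pow_ne_zero _ (NeZero.ne _)
    have hzero : t' * Multiplicative.toAdd (κ₁ τ) + (-s') * Multiplicative.toAdd (κ₂ τ) = 0 := by
      have : (p : ℤ_[p]) ^ e * (t' * Multiplicative.toAdd (κ₁ τ) + (-s') * Multiplicative.toAdd (κ₂ τ))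
          = 0 := by
        linear_combination hprop
      exact (mul_eq_zero.mp this).resolve_left hpe
    rw [ZpExtension.mem_kerSubgroup, ZpExtension.ofLinComb_apply, hzero, ofAdd_zero]
  · -- (iii) saturation
    have hlin : t' * Multiplicative.toAdd (κ₁ σ) + (-s') * Multiplicative.toAdd (κ₂ σ) = 0 := by
      have h := hσ
      rw [ZpExtension.ofLinComb_apply, ← ofAdd_zero] at h
      exact Multiplicative.ofAdd.injective h
    -- the coordinates of `σ` are `λ (s', t')`
    obtain ⟨lam, hl1, hl2⟩ : ∃ lam : ℤ_[p], Multiplicative.toAdd (κ₁ σ) = lam * s' ∧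
        Multiplicative.toAdd (κ₂ σ) = lam * t' := by
      rcases hunit with hs' | ht'
      · obtain ⟨u, hu⟩ := hs'
        refine ⟨Multiplicative.toAdd (κ₁ σ) * ↑u⁻¹, by rw [mul_assoc, ← hu, Units.inv_mul, mul_one], ?_⟩
        have hts : s' * Multiplicative.toAdd (κ₂ σ) = t' * Multiplicative.toAdd (κ₁ σ) := by
          linear_combination -hlin
        calc Multiplicative.toAdd (κ₂ σ) = ↑u⁻¹ * (s' * Multiplicative.toAdd (κ₂ σ)) := by
              rw [← hu, ← mul_assoc, Units.inv_mul, one_mul]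
          _ = Multiplicative.toAdd (κ₁ σ) * ↑u⁻¹ * t' := by rw [hts]; ring
      · obtain ⟨u, hu⟩ := ht'
        refine ⟨Multiplicative.toAdd (κ₂ σ) * ↑u⁻¹, ?_, by rw [mul_assoc, ← hu, Units.inv_mul, mul_one]⟩
        have hts : t' * Multiplicative.toAdd (κ₁ σ) = s' * Multiplicative.toAdd (κ₂ σ) := by
          linear_combination hlin
        calc Multiplicative.toAdd (κ₁ σ) = ↑u⁻¹ * (t' * Multiplicative.toAdd (κ₁ σ)) := by
              rw [← hu, ← mul_assoc, Units.inv_mul, one_mul]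
          _ = Multiplicative.toAdd (κ₂ σ) * ↑u⁻¹ * s' := by rw [hts]; ring
    -- `r(τ₀) = 1` since `r` is unramified at `v̄`
    have hr0 : avatarValueAt r τ₀ = 1 := by
      rw [avatarValueAt, hrunr 𝔓₀ h𝔓₀ τ₀ hτ₀]; simp
    -- `σ^{pᵉ}` has coordinates `λ (s, t)`
    have hpow1 : Multiplicative.toAdd (κ₁ (σ ^ p ^ e)) = lam * Multiplicative.toAdd (κ₁ τ₀) := by
      rw [map_pow, toAdd_pow, nsmul_eq_mul, hl1, ← hs_def, hs]; push_cast; ring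
    have hpow2 : Multiplicative.toAdd (κ₂ (σ ^ p ^ e)) = lam * Multiplicative.toAdd (κ₂ τ₀) := by
      rw [map_pow, toAdd_pow, nsmul_eq_mul, hl2, ← ht_def, ht]; push_cast; ring
    have hval := avatarValueAt_eq_one_of_pairMap_eq_mul hpair hrpair hr0 lam (σ ^ p ^ e) hpow1 hpow2
    rw [RamifiedSevenEllipticUnits.LemmaXi.avatarValueAt_pow] at hval
    exact eq_one_of_avatarValueAt_eq_one (htors σ e hval)

/-! ### §4. Packaged for the consumer: type-`(k, 0)` characters through the pair factor through the line -/

/-- **The split-prime line carries every type-`(k, 0)` interpolation character through the pair**: for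
`K` imaginary quadratic, `p` odd and split, `ι` normalised by the frames' clause `hι` and a generator pair,
ONE `ℤ_p`-quotient `κ` THROUGH THE PAIR and UNRAMIFIED AT `v̄` (the hypotheses of
`IsKatzMeasure₂.isKatzBranch_monomialLine` and of Gillard's theorem) carries every `p`-adic avatar `r`, through
the pair and with `‖r(σ) − 1‖ < ‖p‖`, of every Hecke character of type `(k, 0)` unramified at `v̄`:
`FactorsThroughZp κ r` (§1 + §3); with `ZpExtension.avatarValueAt_eq_onePlusPow` the frame's nodes
`(r(γ₁) − 1, r(γ₂) − 1)` then lie on the monomial line of direction `(κ(γ₁), κ(γ₂))`. -/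
theorem exists_splitPrimeLine_factorsThroughZp (hK : IsImaginaryQuadratic K) (hp2 : p ≠ 2)
    (ι : PadicAlgCl p ≃+* ℂ) {v vbar : HeightOneSpectrum (𝓞 K)} (hpv : ((p : ℕ) : 𝓞 K) ∈ v.asIdeal)
    (hpvbar : ((p : ℕ) : 𝓞 K) ∈ vbar.asIdeal) (hne : vbar ≠ v)
    (hι : ∀ (w : InfinitePlace K) (d : 𝓞 K), d ∈ v.asIdeal ↔ ‖ι.symm (w.embedding (d : K))‖ < 1)
    {κ₁ κ₂ : ZpExtension K p} {γ₁ γ₂ : absoluteGaloisGroup K}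
    (hpair : ZpExtension.IsTopGeneratorPair κ₁ κ₂ γ₁ γ₂) :
    ∃ κ : ZpExtension K p, ZpExtension.pairKer κ₁ κ₂ ≤ κ.kerSubgroup ∧
      (∀ 𝔓 ∈ vbar.primesAbove, 𝔓.inertia (absoluteGaloisGroup K) ≤ κ.kerSubgroup) ∧
      ∀ (φ : HeckeCharacter K) (k : ℤ) (T : Finset (HeightOneSpectrum (𝓞 K)))
        (r : FramedGaloisRep K (PadicAlgCl p) 1),
        φ.HasInfinityType (fun _ ↦ k) (fun _ ↦ 0) → (∀ w, w ∉ T → φ.IsUnramifiedAt w) →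
        φ.IsUnramifiedAt vbar → IsPAdicAvatarOf ι φ r → FactorsThroughPair κ₁ κ₂ r →
        (∀ σ : absoluteGaloisGroup K, ‖avatarValueAt r σ - 1‖ < ‖(p : ℂ_[p])‖) →
        FactorsThroughZp κ r := by
  have himag : ∀ w : InfinitePlace K, w.IsComplex := fun w ↦ hK.2.isComplex w
  obtain ⟨κ, hκpair, hκinert, hsat⟩ := exists_splitPrimeLine_saturated hK hp2 hpv hpvbar hne hpair
  refine ⟨κ, hκpair, hκinert, fun φ k T r hinf hT hunr hav hrpair hsmall ↦ ?_⟩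
  exact hsat r hrpair (isUnramifiedAt_avatar_of_hasInfinityType_zero ι himag hpvbar hne hι hinf hT hunr hav)
    (avatarValueAt_torsionFree_of_norm_sub_one_lt hsmall)

end Summit.BirchSwinnertonDyer.BirchSwinnertonDyer.Theorems
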